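import Literature.AnabelianGeometry.AbsoluteAnabelian.AbsTopIII.FrobeniusPictureMLFTelecoreConstruction
import Literature.AnabelianGeometry.AbsoluteAnabelian.AbsTopIII.FrobeniusPictureMLFIncompatibility
import Literature.AnabelianGeometry.AbsoluteAnabelian.AbsTopIII.FrobeniusPictureMLFShift
import Literature.AnabelianGeometry.AbsoluteAnabelian.AbsTopIII.LogFrobeniusObservableProofs
import Literature.AnabelianGeometry.AbsoluteAnabelian.AbsTopIII.AutHolLogFrobenius

/-!
# [AbsTopIII] Corollary 3.6 (ii) DISCHARGED: the homotopies of `ℋ_An` on its generators; the theorem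

S. Mochizuki, *Topics in Absolute Anabelian Geometry III*, Cor. 3.6 (ii) pp. 79–80 (manuscript
`paper:url-5493eb38cbb7`; bib key `MochizukiAbsTopIII2015`).  Continuation of
`FrobeniusPictureMLFTelecoreConstruction.lean` (seat abc-iut-L4-t5): there the telecore `𝔗_An`
(`anTelecore`) over the core `(𝒟_{≤5}, Anab)` and the contact structure `ℋ_An` (`anContact`, the
universal family of `𝒟_An` restricted to the saturation of the printed generators) are built from
structure functors to `𝒳`.  Here we COMPUTE the homotopies of `ℋ_An` on the printed generators —
`η_{□⋎} = e⁻¹` (in print "the identity natural transformation from the arrow `φ_□ : Anab → 𝒳` to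
the composite arrow `id_⋎ ∘ φ_⋎ : Anab → 𝒳`", i.e. `e = 𝟙` there), `η_□ = η_An`, and, under the coherence hypothesis on `η₁`, `η_⋎ = η₁` ("the isomorphism
arising from `η_An`") — and assemble **`telecoreStmt_of_coherent : Δ.TelecoreStmt τ`**, i.e. the
typed Cor. 3.6 (ii) of `FrobeniusPictureMLFTelecore.lean`, for every `Δ` with fully faithful
`id_⋎` and every coherent `τ`; seat abc-iut-L4-t10's `AbsTopIII.Cor_4_5_ii` (Cor. 4.5 (ii), the
same typed statement on archimedean data) follows verbatim (`cor_4_5_ii_of_coherent`).  Finally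
`logFrobeniusCompatible_of` ASSEMBLES the whole of Cor. 3.6, `LogFrobeniusCompatible Δ τ` (one field
per printed item (i)–(v)), from the tree's discharges of the five items: it holds for every MLF-type
datum (`ι_× : λ^× → λ^{×pf}`) with the Lemma-3.4 property (Lemma 3.4), totally rigid first two rows
(Prop. 3.2 (iv)), fully faithful `id_⋎`, coherent `τ` and nonempty first row — i.e. Cor. 3.6 is
reduced to its printed model-dependent inputs.

Method: the homotopy of `ℋ_An` on a pair into `□` (resp. `⋎`) is the lift through the structure
functor `𝟭_𝒳` (resp. `id_⋎`) of `pathIso γ₁ ∘ pathIso γ₂⁻¹` (`DiagramLifts`); the `pathIso` along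
the four generator paths are unwound edge by edge (`μ` = `𝟙`, `e`, `η_An ∘ eqToIso`), the
`eqToHom` bookkeeping being done heterogeneously.  Nothing here takes a side on inter-universal
Teichmüller theory.
-/

namespace Literature.AnabelianGeometry.AbsoluteAnabelian

open _root_.CategoryTheory _root_.Quiver

universe u

namespace LogFrobeniusData

open DiagramOfCategories

variable (Δ : LogFrobeniusData.{u}) (τ : Δ.TelecoreData)

section Generators

variable (hν : Δ.toNexus.FullyFaithful)

/-! ### The homotopies of `ℋ_An` on the printed generators -/

/-- The homotopy of `ℋ_An` on a pair of paths into a vertex `w ≠ 𝒩` is the lift there. [folklore] -/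
private theorem anContact_η_eq_lift {a w : (teleShape anJ.{u}).Vertex} (hw : anW w) (p q : Path a w)
    (h : (Δ.anContact τ hν).E p q) :
    (Δ.anContact τ hν).η h = (Δ.anOver τ).lift (Δ.anFF τ hν w hw) p q :=
  teleUnivFamily_η_eq_lift coreShape5 Δ.coreExt5 Δ.overX Δ.φ Δ.anCI anJ (Δ.anTelMap τ) (Δ.anCJ τ)
    anW (Δ.anFF τ hν) hw p q _

/-- The structure isomorphisms of `𝒟_An` on the edges met by the generators (definitional
unfoldings). [folklore] -/
private theorem anOver_μ_phiNexus (j : anJ.{u} (vx 4 .nexus (by decide))) :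
    (Δ.anOver τ).μ (ePhi j : tvObs anJ ⟶ tvNexus anJ) = Δ.φ.rightUnitor := rfl

/-- `μ` on the telecore edge `φ_⋎` is `e` (definitional unfolding). [folklore] -/
private theorem anOver_μ_phiRow1 (n : ℤ) (jn : anJ.{u} (vx 4 (.row1 n) (by simp [LFVertex.row]))) :
    (Δ.anOver τ).μ (ePhi jn : tvObs anJ ⟶ tvRow1 anJ n) = τ.e := rfl

/-- `μ` on `id_⋎` is the unitor (definitional unfolding). [folklore] -/
private theorem anOver_μ_idEdge (n : ℤ) :
    (Δ.anOver τ).μ (show tvRow1 anJ.{u} n ⟶ tvNexus anJ from LFVertex.idEdge n) =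
      Δ.toNexus.rightUnitor := rfl

/-- `μ` on `𝒩 → ℰ` is the identity (definitional unfolding). [folklore] -/
private theorem anOver_μ_edge34 :
    (Δ.anOver τ).μ (show tvThird anJ.{u} ⟶ tvFourth anJ from LFVertex.edge34) = Iso.refl _ := rfl

/-- `μ` on `κ_An` is the identity (definitional unfolding). [folklore] -/
private theorem anOver_μ_kappa :
    (Δ.anOver τ).μ (show tvFourth anJ.{u} ⟶ tvObs anJ from
      (PUnit.unit : coreI5.{u} (vx 4 .fourth (by decide)))) = Iso.refl _ := rfl

/-- `μ` on `λ^×` is `eqToIso ≪≫ η_An` (definitional unfolding). [folklore] -/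
private theorem anOver_μ_lamTimes :
    (Δ.anOver τ).μ (show tvNexus anJ.{u} ⟶ tvThird anJ from LFVertex.lamTimesEdge) =
      eqToIso (show Δ.lamTimes ⋙ (Δ.NtoE ⋙ Δ.κ ⋙ Δ.φ) = Δ.XtoE ⋙ Δ.κ ⋙ Δ.φ by
        rw [← Functor.assoc, Δ.lamTimes_NtoE]) ≪≫ Δ.η := rfl

/-- `eqToHom`s are heterogeneously identities (bookkeeping). [folklore] -/
private theorem eqToHom_heq_id {C : Type u} [Category.{u} C] {X Y Z : C} (r : X = Z) (h : Z = Y) :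
    eqToHom r ≍ 𝟙 Y := by
  subst r h; simp

/-- Components of a natural transformation at equal objects are heterogeneously equal. [folklore] -/
private theorem app_heq {A B : Type u} [Category.{u} A] [Category.{u} B] {F G : A ⥤ B}
    (α : F ⟶ G) {y y' : A} (hy : y = y') : α.app y ≍ α.app y' := by
  subst hy; rfl

/-- Stripping a leading identity under `≍` (bookkeeping). [folklore] -/
private theorem id_comp_heq_iff {C : Type u} [Category.{u} C] {X Y X' Y' : C} (f : X ⟶ Y)
    (g : X' ⟶ Y') : 𝟙 X ≫ f ≍ g ↔ f ≍ g := by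
  rw [Category.id_comp]

/-- Reassociating under `≍` (bookkeeping). [folklore] -/
private theorem assoc_heq_iff {C : Type u} [Category.{u} C] {V W X Y X' Y' : C} (f : V ⟶ W)
    (g : W ⟶ X) (k : X ⟶ Y) (l : X' ⟶ Y') : (f ≫ g) ≫ k ≍ l ↔ f ≫ g ≫ k ≍ l := by
  rw [Category.assoc]

/-- `pathIso [φ_□]` is the identity (through `𝟭 ∘ φ_□ = φ_An`). [folklore] -/
private theorem pathIso_phiNexus_heq (j : anJ.{u} (vx 4 .nexus (by decide)))
    (a : (Δ.teleDiagram anJ (Δ.anTelMap τ)).obj (tvObs anJ)) :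
    ((Δ.anOver τ).pathIso (pathPhiNexus j)).hom.app a ≍ 𝟙 (Δ.φ.obj a) := by
  erw [pathPhiNexus, OverData.pathIso_cons_app, OverData.pathIso_nil_app, anOver_μ_phiNexus]
  refine (eqToHom_comp_heq_iff _ _ _).2 ((id_comp_heq_iff _ _).2 ?_)
  exact eqToHom_heq_id _ rfl

/-- `pathIso ([id_⋎]∘[φ_⋎])` is `e : id_⋎ ∘ φ_⋎ ≅ φ_An`. [folklore] -/
private theorem pathIso_phiId_heq (n : ℤ) (jn : anJ.{u} (vx 4 (.row1 n) (by simp [LFVertex.row])))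
    (a : (Δ.teleDiagram anJ (Δ.anTelMap τ)).obj (tvObs anJ)) :
    ((Δ.anOver τ).pathIso (pathPhiId n jn)).hom.app a ≍ τ.e.hom.app a := by
  erw [pathPhiId, OverData.pathIso_cons_app, OverData.pathIso_cons_app, OverData.pathIso_nil_app,
    anOver_μ_idEdge, anOver_μ_phiRow1]
  refine (eqToHom_comp_heq_iff _ _ _).2 ((id_comp_heq_iff _ _).2
    ((eqToHom_comp_heq_iff _ _ _).2 ((comp_eqToHom_heq_iff _ _ _).2 ?_)))
  exact app_heq τ.e.hom (Functor.congr_obj ((Δ.teleDiagram anJ (Δ.anTelMap τ)).pathFunctor_nil _) a)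

/-- `pathIso [β¹_□]` is `η_An` (through `λ^× ⋙ (𝒩 → ℰ) = (𝒳 → ℰ)`). [folklore] -/
private theorem pathIso_betaNexus_heq (j : anJ.{u} (vx 4 .nexus (by decide)))
    (x : (Δ.teleDiagram anJ (Δ.anTelMap τ)).obj (tvNexus anJ)) :
    ((Δ.anOver τ).pathIso (pathBetaNexus j)).hom.app x ≍ Δ.η.hom.app x := by
  erw [pathBetaNexus, OverData.pathIso_cons_app, OverData.pathIso_cons_app,
    OverData.pathIso_cons_app, OverData.pathIso_cons_app, OverData.pathIso_nil_app,
    anOver_μ_phiNexus, anOver_μ_kappa, anOver_μ_edge34, anOver_μ_lamTimes]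
  refine (eqToHom_comp_heq_iff _ _ _).2 ((id_comp_heq_iff _ _).2
    ((eqToHom_comp_heq_iff _ _ _).2 ((id_comp_heq_iff _ _).2
    ((eqToHom_comp_heq_iff _ _ _).2 ((id_comp_heq_iff _ _).2
    ((eqToHom_comp_heq_iff _ _ _).2 ((comp_eqToHom_heq_iff _ _ _).2 ?_)))))))
  erw [Iso.trans_hom, NatTrans.comp_app, eqToIso.hom, eqToHom_app]
  refine (eqToHom_comp_heq_iff _ _ _).2 ?_
  exact app_heq Δ.η.hom (Functor.congr_obj ((Δ.teleDiagram anJ (Δ.anTelMap τ)).pathFunctor_nil _) x)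

/-- Objects along `[β¹_⋎]`: after `id_⋎, λ^×, 𝒩 → ℰ, κ_An` one reaches `κ_An((𝒳 → ℰ)(id_⋎ x))`.
[folklore] -/
private theorem betaRow1_obj₄ (n : ℤ) (x : (Δ.teleDiagram anJ (Δ.anTelMap τ)).obj (tvRow1 anJ n)) :
    ((Δ.teleDiagram anJ (Δ.anTelMap τ)).pathFunctor
      (((((Path.nil : Path (tvRow1 anJ.{u} n) (tvRow1 anJ n)).cons
        (show tvRow1 anJ n ⟶ tvNexus anJ from LFVertex.idEdge n)).cons
        (show tvNexus anJ ⟶ tvThird anJ from LFVertex.lamTimesEdge)).cons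
        (show tvThird anJ ⟶ tvFourth anJ from LFVertex.edge34)).cons
        (show tvFourth anJ ⟶ tvObs anJ from (PUnit.unit : coreI5.{u} (vx 4 .fourth (by decide)))))).obj x =
      Δ.κ.obj (Δ.XtoE.obj (Δ.toNexus.obj x)) := by
  simp only [pathFunctor_cons, pathFunctor_nil]
  change Δ.κ.obj (Δ.NtoE.obj (Δ.lamTimes.obj (Δ.toNexus.obj x))) = _
  rw [← Functor.comp_obj Δ.lamTimes Δ.NtoE, Δ.lamTimes_NtoE]

/-- Objects along `[β¹_⋎]`: after `id_⋎` one reaches `id_⋎ x`. [folklore] -/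
private theorem betaRow1_obj₁ (n : ℤ) (x : (Δ.teleDiagram anJ (Δ.anTelMap τ)).obj (tvRow1 anJ n)) :
    ((Δ.teleDiagram anJ (Δ.anTelMap τ)).pathFunctor
      ((Path.nil : Path (tvRow1 anJ.{u} n) (tvRow1 anJ n)).cons
        (show tvRow1 anJ n ⟶ tvNexus anJ from LFVertex.idEdge n))).obj x = Δ.toNexus.obj x := by
  simp only [pathFunctor_cons, pathFunctor_nil]
  rfl

/-- `pathIso [β¹_⋎]` is `(e ▷ π_An) ∘ (η_An ◁ id_⋎)` componentwise. [folklore] -/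
private theorem pathIso_betaRow1_heq (n : ℤ) (jn : anJ.{u} (vx 4 (.row1 n) (by simp [LFVertex.row])))
    (x : (Δ.teleDiagram anJ (Δ.anTelMap τ)).obj (tvRow1 anJ n)) :
    ((Δ.anOver τ).pathIso (pathBetaRow1 n jn)).hom.app x ≍
      τ.e.hom.app (Δ.κ.obj (Δ.XtoE.obj (Δ.toNexus.obj x))) ≫ Δ.η.hom.app (Δ.toNexus.obj x) := by
  erw [pathBetaRow1, OverData.pathIso_cons_app, OverData.pathIso_cons_app,
    OverData.pathIso_cons_app, OverData.pathIso_cons_app, OverData.pathIso_cons_app,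
    OverData.pathIso_nil_app, anOver_μ_phiRow1, anOver_μ_kappa, anOver_μ_edge34, anOver_μ_lamTimes,
    anOver_μ_idEdge]
  refine (eqToHom_comp_heq_iff _ _ _).2 ?_
  refine heq_comp (by rw [betaRow1_obj₄]; rfl) (by rw [betaRow1_obj₄]; rfl) rfl
    (app_heq τ.e.hom (Δ.betaRow1_obj₄ τ n x)) ?_
  refine (eqToHom_comp_heq_iff _ _ _).2 ((id_comp_heq_iff _ _).2
    ((eqToHom_comp_heq_iff _ _ _).2 ((id_comp_heq_iff _ _).2
    ((eqToHom_comp_heq_iff _ _ _).2 ((assoc_heq_iff _ _ _ _).2 ?_)))))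
  first
    | erw [Iso.trans_hom, NatTrans.comp_app, eqToIso.hom, eqToHom_app]
    | erw [eqToIso.hom, eqToHom_app]
  refine (eqToHom_comp_heq_iff _ _ _).2 ?_
  refine HEq.trans ?_ (heq_of_eq (Category.comp_id _))
  refine heq_comp (by rw [betaRow1_obj₁]; rfl) (by rw [betaRow1_obj₁]; rfl) rfl
    (app_heq Δ.η.hom (Δ.betaRow1_obj₁ τ n x)) ?_
  refine (eqToHom_comp_heq_iff _ _ _).2 ((id_comp_heq_iff _ _).2 ?_)
  exact eqToHom_heq_id _ rfl

/-- The inverse of an isomorphism is determined heterogeneously by its hom part (bookkeeping). [folklore] -/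
private theorem iso_inv_heq {C : Type u} [Category.{u} C] {X Y X' Y' : C} (i : X ≅ Y) (i' : X' ≅ Y')
    (hX : X = X') (hY : Y = Y') (h : i.hom ≍ i'.hom) : i.inv ≍ i'.inv := by
  subst hX hY
  obtain rfl : i = i' := Iso.ext (eq_of_heq h)
  rfl

/-- `pathIso` of the empty path is the identity, inverse component (bookkeeping). [folklore] -/
private theorem pathIso_nil_inv_heq {v : (teleShape anJ.{u}).Vertex}
    (x : (Δ.teleDiagram anJ (Δ.anTelMap τ)).obj v) :
    ((Δ.anOver τ).pathIso (Path.nil : Path v v)).inv.app x ≍ 𝟙 (((Δ.anOver τ).N v).obj x) := by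
  erw [OverData.pathIso, eqToIso.inv, eqToHom_app]
  exact eqToHom_heq_id _
    (congrArg ((Δ.anOver τ).N v).obj (Functor.congr_obj ((Δ.teleDiagram anJ (Δ.anTelMap τ)).pathFunctor_nil v) x))

/-- **`η_{□⋎} = e⁻¹`** (the identity in print): the homotopy of `ℋ_An` on the generator
`([φ_□], [id_⋎]∘[φ_⋎])`. [cite: MochizukiAbsTopIII2015, Corollary 3.6 (ii) p.80] -/
theorem anContact_etaSq (n : ℤ) (j : anJ.{u} (vx 4 .nexus (by decide)))
    (jn : anJ.{u} (vx 4 (.row1 n) (by simp [LFVertex.row])))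
    (h : (Δ.anContact τ hν).E (pathPhiNexus j) (pathPhiId n jn)) (a : Δ.A)
    (e₁ : ((Δ.teleDiagram anJ (Δ.anTelMap τ)).pathFunctor (pathPhiNexus j)).obj a = Δ.φ.obj a)
    (e₂ : ((Δ.teleDiagram anJ (Δ.anTelMap τ)).pathFunctor (pathPhiId n jn)).obj a =
      Δ.toNexus.obj (τ.φ₁.obj a)) :
    ((Δ.anContact τ hν).η h).app a = eqToHom e₁ ≫ τ.e.inv.app a ≫ eqToHom e₂.symm := by
  refine (conj_eqToHom_iff_heq _ _ e₁ e₂).2 ?_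
  rw [Δ.anContact_η_eq_lift τ hν (w := tvNexus anJ) trivial]
  have key : ((Δ.anOver τ).lift (Δ.anFF τ hν (tvNexus anJ) trivial) (pathPhiNexus j)
      (pathPhiId n jn)).app a = ((Δ.anOver τ).pathIso (pathPhiNexus j)).hom.app a ≫
        ((Δ.anOver τ).pathIso (pathPhiId n jn)).inv.app a :=
    (Δ.anOver τ).map_lift_app (Δ.anFF τ hν (tvNexus anJ) trivial) (pathPhiNexus j) (pathPhiId n jn) a
  rw [key]
  refine HEq.trans ?_ (heq_of_eq (Category.id_comp (τ.e.inv.app a)))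
  refine heq_comp e₁ rfl e₂ (Δ.pathIso_phiNexus_heq τ j a) ?_
  exact iso_inv_heq (((Δ.anOver τ).pathIso (pathPhiId n jn)).app a) (τ.e.app a) e₂ rfl
    (Δ.pathIso_phiId_heq τ n jn a)

/-- **`η_□ = η_An`**: the homotopy of `ℋ_An` on the generator `([β¹_□], [β⁰_□])`.
[cite: MochizukiAbsTopIII2015, Corollary 3.6 (ii) p.79] -/
theorem anContact_etaNexus (j : anJ.{u} (vx 4 .nexus (by decide)))
    (h : (Δ.anContact τ hν).E (pathBetaNexus j) Path.nil) (x : Δ.X)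
    (e₁ : ((Δ.teleDiagram anJ (Δ.anTelMap τ)).pathFunctor (pathBetaNexus j)).obj x =
      Δ.φ.obj (Δ.κ.obj (Δ.XtoE.obj x)))
    (e₂ : ((Δ.teleDiagram anJ (Δ.anTelMap τ)).pathFunctor
      (Path.nil : Path (tvNexus anJ) (tvNexus anJ))).obj x = x) :
    ((Δ.anContact τ hν).η h).app x = eqToHom e₁ ≫ Δ.η.hom.app x ≫ eqToHom e₂.symm := by
  refine (conj_eqToHom_iff_heq _ _ e₁ e₂).2 ?_
  rw [Δ.anContact_η_eq_lift τ hν (w := tvNexus anJ) trivial]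
  have key : ((Δ.anOver τ).lift (Δ.anFF τ hν (tvNexus anJ) trivial) (pathBetaNexus j)
      Path.nil).app x = ((Δ.anOver τ).pathIso (pathBetaNexus j)).hom.app x ≫
        ((Δ.anOver τ).pathIso (Path.nil : Path (tvNexus anJ) (tvNexus anJ))).inv.app x :=
    (Δ.anOver τ).map_lift_app (Δ.anFF τ hν (tvNexus anJ) trivial) (pathBetaNexus j) Path.nil x
  rw [key]
  refine HEq.trans ?_ (heq_of_eq (Category.comp_id (Δ.η.hom.app x)))
  exact heq_comp e₁ rfl e₂ (Δ.pathIso_betaNexus_heq τ j x) (Δ.pathIso_nil_inv_heq τ (v := tvNexus anJ) x)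

/-- **`η_⋎ = η₁`** (`= η_An` in print): the homotopy of `ℋ_An` on the generator `([β¹_⋎], [β⁰_⋎])`,
under the coherence of `η₁` with `e` and `η_An`. [cite: MochizukiAbsTopIII2015, Corollary 3.6 (ii) p.79] -/
theorem anContact_etaRow1
    (hτ : ∀ x : Δ.X₁, Δ.toNexus.map (τ.η₁.hom.app x) =
      τ.e.hom.app (Δ.κ.obj (Δ.XtoE.obj (Δ.toNexus.obj x))) ≫ Δ.η.hom.app (Δ.toNexus.obj x))
    (n : ℤ) (jn : anJ.{u} (vx 4 (.row1 n) (by simp [LFVertex.row])))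
    (h : (Δ.anContact τ hν).E (pathBetaRow1 n jn) Path.nil) (x : Δ.X₁)
    (e₁ : ((Δ.teleDiagram anJ (Δ.anTelMap τ)).pathFunctor (pathBetaRow1 n jn)).obj x =
      τ.φ₁.obj (Δ.κ.obj (Δ.XtoE.obj (Δ.toNexus.obj x))))
    (e₂ : ((Δ.teleDiagram anJ (Δ.anTelMap τ)).pathFunctor
      (Path.nil : Path (tvRow1 anJ n) (tvRow1 anJ n))).obj x = x) :
    ((Δ.anContact τ hν).η h).app x = eqToHom e₁ ≫ τ.η₁.hom.app x ≫ eqToHom e₂.symm := by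
  rw [Δ.anContact_η_eq_lift τ hν (w := tvRow1 anJ n) trivial]
  refine (Δ.anFF τ hν (tvRow1 anJ n) trivial).map_injective ?_
  have key := (Δ.anOver τ).map_lift_app (Δ.anFF τ hν (tvRow1 anJ n) trivial) (pathBetaRow1 n jn)
    Path.nil x
  rw [key]
  erw [Functor.map_comp, Functor.map_comp, eqToHom_map, eqToHom_map]
  refine (conj_eqToHom_iff_heq' _ _ _ _).2 ?_
  refine HEq.trans ?_ (heq_of_eq (hτ x).symm)
  refine HEq.trans ?_ (heq_of_eq (Category.comp_id _))
  exact heq_comp (congrArg Δ.toNexus.obj e₁) rfl (congrArg Δ.toNexus.obj e₂)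
    (Δ.pathIso_betaRow1_heq τ n jn x) (Δ.pathIso_nil_inv_heq τ (v := tvRow1 anJ n) x)

end Generators

/-! ### Corollary 3.6 (ii) -/

/-- **[AbsTopIII] Cor. 3.6 (ii), PROVED over the abstract data**: for every `Δ : LogFrobeniusData`
whose `id_⋎ = toNexus` is fully faithful (printed case: `𝒳₁ = 𝒳`, `id_⋎ = 𝟭`) and every first-row
telecore datum `τ = (φ_⋎, e, η_⋎)` whose `η_⋎` is the isomorphism "arising from `η_An`" —
`id_⋎ (η_⋎)_x = e_{π_An(id_⋎ x)} ∘ (η_An)_{id_⋎ x}` (printed case `φ_⋎ = φ_An`, `e = 𝟙`,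
`η_⋎ = η_An`: trivially) — the typed statement `TelecoreStmt τ` holds: over the core
`(𝒟_{≤5}, Anab)` there is a telecore `𝔗_An` of the printed shape (edges `φ_⋏`, `⋏ ∈ L†`) with a
contact structure `ℋ_An` generated by `{η_{□⋎}^{±1}, η_⋏^{±1}}` whose homotopies on the generators
are the printed ones. [cite: MochizukiAbsTopIII2015, Corollary 3.6 (ii) pp.79–80] -/
theorem telecoreStmt_of_coherent (hν : Δ.toNexus.FullyFaithful)
    (hτ : ∀ x : Δ.X₁, Δ.toNexus.map (τ.η₁.hom.app x) =
      τ.e.hom.app (Δ.κ.obj (Δ.XtoE.obj (Δ.toNexus.obj x))) ≫ Δ.η.hom.app (Δ.toNexus.obj x)) :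
    Δ.TelecoreStmt τ :=
  ⟨Δ.anCoreFamily, univCoreFamily_terminal _ _ _ _ _ _ _,
    univCoreObs_isCore coreShape5 (fun _ => inferInstanceAs (IsEmpty PEmpty)) Δ.coreExt5 Δ.overX Δ.φ
      Δ.anCI Δ.ffφ reaches5,
    Δ.anTelecore τ hν, Δ.anTelecore_isTelecoreAn τ hν, Δ.anContact τ hν,
    Δ.anContact_isContactStructure τ hν, Δ.anContact_isGeneratedBy τ hν,
    fun n j jn h a e₁ e₂ => Δ.anContact_etaSq τ hν n j jn h a e₁ e₂,
    fun j h x e₁ e₂ => Δ.anContact_etaNexus τ hν j h x e₁ e₂,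
    fun n jn h x e₁ e₂ => Δ.anContact_etaRow1 τ hν hτ n jn h x e₁ e₂⟩

/-- **[AbsTopIII] Cor. 4.5 (ii)** (seat abc-iut-L4-t10's `Cor_4_5_ii`, literally the same typed
statement on the archimedean data), PROVED under the same hypotheses.
[cite: MochizukiAbsTopIII2015, Corollary 4.5 (ii) p.107] -/
theorem cor_4_5_ii_of_coherent (hν : Δ.toNexus.FullyFaithful)
    (hτ : ∀ x : Δ.X₁, Δ.toNexus.map (τ.η₁.hom.app x) =
      τ.e.hom.app (Δ.κ.obj (Δ.XtoE.obj (Δ.toNexus.obj x))) ≫ Δ.η.hom.app (Δ.toNexus.obj x)) :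
    AbsTopIII.Cor_4_5_ii Δ τ :=
  Δ.telecoreStmt_of_coherent τ hν hτ


/-! ### Corollary 3.6 assembled from its discharged items -/

/-- **[AbsTopIII] Cor. 3.6 (i)–(v) over the abstract data, REDUCED TO ITS PRINTED INPUTS**: the
assembled statement `LogFrobeniusCompatible Δ τ` holds for every MLF-type log-Frobenius datum
(`ι_× : λ^× → λ^{×pf}`) such that `ι_×` has the Lemma-3.4 property (Lemma 3.4: no isomorphism splits
it), the first two rows `𝒟_{≤□}` are totally rigid (Prop. 3.2 (iv): `𝒞^{MLF-sB}_T` is id-rigid),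
`id_⋎` is fully faithful and `τ` is coherent (printed case: identities), and the first row is
nonempty.  Items: (i) `coreStmt4/5/6` (seat t5), (ii) `telecoreStmt_of_coherent` (this file), (iii)
`observableLogStmt` (seat t10), (iv) `incompatibleStmt_of_lemma34` /
`telecoreIncompatibleStmt_of_lemma34` (t5), (v) `nexusRigidStmt_iff`, `shiftStmt` (t5).
[cite: MochizukiAbsTopIII2015, Corollary 3.6 (i)–(v) pp.78–80] -/
theorem logFrobeniusCompatible_of (hν : Δ.toNexus.FullyFaithful)
    (hτ : ∀ x : Δ.X₁, Δ.toNexus.map (τ.η₁.hom.app x) =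
      τ.e.hom.app (Δ.κ.obj (Δ.XtoE.obj (Δ.toNexus.obj x))) ≫ Δ.η.hom.app (Δ.toNexus.obj x))
    (ι : Δ.lamTimes ⟶ Δ.lamPf) (hι : Δ.ιtimes = Sum.inl ι) (h34 : Lemma34Property ι) (x₀ : Δ.X₁)
    (hrig : (Δ.diagram.restrict ({a : LFVertex | a.row = 1} ∪ {LFVertex.nexus})).IsTotallyRigid) :
    Δ.LogFrobeniusCompatible τ where
  core4 := Δ.coreStmt4
  core5 := Δ.coreStmt5
  core6 := Δ.coreStmt6
  telecore := Δ.telecoreStmt_of_coherent τ hν hτ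
  observable_log := Δ.observableLogStmt
  incompatible_core := Δ.incompatibleStmt_of_lemma34 ι hι x₀ h34
  incompatible_telecore :=
    Δ.telecoreIncompatibleStmt_of_lemma34 τ ι hι (Δ.κ.obj (Δ.XtoE.obj (Δ.toNexus.obj x₀))) h34
  nexus_rigid := Δ.nexusRigidStmt_iff.mpr hrig
  shift := Δ.shiftStmt

end LogFrobeniusData

end Literature.AnabelianGeometry.AbsoluteAnabelian
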